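import Summits.BirchSwinnertonDyer.BirchSwinnertonDyer.Theorems.SignedLowerHalvesSprungLowerDivisibilityAtThreeKeyingUnpairedZero
import Summits.BirchSwinnertonDyer.BirchSwinnertonDyer.Theorems.SignedLowerHalvesSprungLowerDivisibilityAtThreeIotaRigiditySelf
import Summits.BirchSwinnertonDyer.BirchSwinnertonDyer.Theorems.PrintX8VSInputHondaSystemPrimalPadic
import Summits.BirchSwinnertonDyer.BirchSwinnertonDyer.Theorems.PrintX8VSInputHondaSystemPrimalTransport
import Summits.BirchSwinnertonDyer.BirchSwinnertonDyer.Theorems.PrintX8VSInputHondaSystemDualClauses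
import Summits.BirchSwinnertonDyer.Rank1Residual.Supersingular.X8PrintDischarge
import Literature.NumberTheory.EllipticCurves.Sprung2012.SharpFlatColemanKatoContragredient
import Literature.NumberTheory.EllipticCurves.Sprung2017.SharpFlatPAdicLFunctionProofs
import Literature.NumberTheory.EllipticCurves.KatoRankBoundProofs
import Literature.NumberTheory.EllipticCurves.CyclotomicZpExtensionLocalGeneratorProofs
import Literature.NumberTheory.EllipticCurves.ModularCurvePeriodRatio
import Literature.NumberTheory.EllipticCurves.IwasawaAlgebraPromotionProofs
import Literature.NumberTheory.EllipticCurves.Rank1Residual.Typed.X8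
import Mathlib.RingTheory.Ideal.GoingUp
import HarnessLib

/-!
# Crux `SprungLowerDivisibilityAtThree` (K1, item stmt-BirchSwinnertonDyer-19875), line `chromatic-common-zeros`:
# THE TYPED INPUT PACK IS INCONSISTENT MODULO ONE ι-SELF-RIGID CELL — the γ-keyed joint Coleman–Kato package fact `hJ`
# (`thm714seq_sharpFlatColemanKato_zetaJoint`) together with Sprung's Thm. 7.16 AS PRINTED (`thm716_…_contra`), Thm. 7.14,
# the period unit at `3` and modularity prove `False` from ONE X8 pair carrying a colour `L^∘` with `μ = 0`, `λ = 2`,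
# `L^∘(0) ≠ 0`, `L^∘(T^ι) ∉ (L^∘)` (the datum of door (R12), generic on the x8 census)

LEAD seat `cruxlead-stmt-BirchSwinnertonDyer-19875` gen 6 (prover; D-0154 KEY (147)(a)/(148)(a) row 8; host `pub/bsd-ssimc`),
2026-08-28. `--supports` 19875 `--as helper`; THEOREMS ONLY (no `def`, no named fact introduced, no `sorry`); route-independent
imports (no `Theses` file in the cone). Closes NOTHING, refutes NOTHING: every hypothesis is a displayed named fact or a displayed
per-pair datum. **BSD is NOT proved; K1 is neither proved nor Lean-refuted; no X8 cell moves.**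

## What, and why it matters for the keying ruling (director-bsd (266) R1′ / (267) «(A) THEN (B)», COHERENCE WARNING)

Two landed mechanisms of this line meet head-on at an `ι`-self-rigid cell:
* (R12) `ChromaticIota.sprungSharpFlatLowerDivisibility_of_lam_two_of_subst_not_mem` (w3 g4, p637195): on an X8 pair, ONE colour
  `L^∘` with `μ(L^∘) = 0`, `λ(L^∘) = 2`, `L^∘(0) ≠ 0`, `L^∘(T^ι) ∉ (L^∘)` gives the TYPED leaf `SprungSharpFlatLowerDivisibility W p •`
  for BOTH colours — modulo `h714`, the period unit `h3`, and **`hJ : thm714seq_sharpFlatColemanKato_zetaJoint`**, the γ-KEYED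
  joint package fact (conjunct (iii) of x8's 22571; x8 ref R-228 / lit T67: FALSE AS TYPED at pairs with a private zero);
* the keying negative `ChromaticKeying.not_sprungSharpFlatLowerDivisibility_of_contraKato_of_unpairedZero` (w3 g8, p662114) with
  its binders CONSTRUCTED (LEAD g6, p665377's packet, redone here per pair): Thm. 7.14 ∧ **Thm. 7.16 IN PRINT KEYING
  (`thm716_sharpFlatCharIdeal_divisibility_contra`)** ∧ period, by name, and ONE `ι`-unpaired zero of `L^•` refute the typed
  leaf at `(W, p, •)`;
and §2 below shows, in pure `Λ`-algebra, that THE (R12) DATUM ITSELF PRODUCES AN `ι`-UNPAIRED ZERO of `L^∘` off `(p)`: `λ = 2`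
makes `L^∘` a non-unit, so some irreducible `π ∣ L^∘` generates a height-one prime `𝔭 ∋ L^∘` (`Λ` is a UFD; Krull), `𝔭 ∌ p`
because `μ(L^∘) = 0`, and `L^∘(T^ι) ∉ 𝔭` is (R12)'s own rigidity lemma `ChromaticIota.not_mem_of_subst_mem_of_lam_two`.
HENCE (§3, `false_of_typedInputsX8_of_iotaSelfRigidCell`):

  `thm714 → period → hJ (γ-keyed) → thm716_contra (print-keyed) → exists_isNewformOf → (ONE X8 pair with the (R12) datum) → False`.

Reading: the γ-keyed package fact `hJ` and the print-keyed Kato divisibility `thm716_contra` CANNOT both be held inputs of one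
route once a single `ι`-self-rigid `λ = 2` cell is certified (x8 R5 / T57–T59: 117 of 142 rank-0 cells have a `λ = 2` colour;
the non-self-duality digit test is generic and decidable from finitely many `3`-adic digits) — the kernel form of the vet's
COHERENCE WARNING behind ruling (267): a guard-only successor that re-keys `h716` to `h716_contra` while `hJ` (22571 (iii)) stays
γ-keyed books an INCONSISTENT pack, not merely «unrestored content»; only the family re-bind (B) (γ⁻¹-keyed
`thm714seq_…_zetaJoint_contra` for `hJ` as well) is coherent. Dually, with `hJ_contra` in place of `hJ` door (R12) no longer
applies as typed (its (R0) engine `sprungSharpFlatLowerDivisibility_of_noCommonZero` consumes the γ-keyed package), which is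
the C′ LEAD's first porting target. Nothing here says which typed fact nature falsifies (R-228/T67 say: `hJ`); the theorem
only says they cannot all be true together with modularity at such a cell.

## Contents
* §1 `not_sprungSharpFlatLowerDivisibility_of_printedKato_of_unpairedZero` — PER-PAIR printed-input negative with the leaf's
  arithmetic binders constructed (cyclotomic `(κ, γ)`, place `v`, local lift `g`, Honda system — Sprung Thm. 2.2 PROVED,
  re-assembled Theses-free —, `ϖ := u⁻¹`, contragredient datum, Kato-print via `.of_thm714`): binders `(W, p, hX, f, pair, •, 𝔭₀)`
  only. (The crux-level form is p665377's `not_sprungLowerDivisibilityAtThree_of_printedKato_of_sprungPairUnpairedZeroX8`.)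
* §2 `exists_heightOne_unpairedZero_of_lam_two_of_subst_not_mem` — pure algebra in `Λ = ℤ_p⟦T⟧`, `p ≠ 2`: `F ≠ 0`, `μ(F) = 0`,
  `λ(F) = 2`, `F(0) ≠ 0`, `F(T^ι) ∉ (F)` ⟹ ∃ height-one `𝔭 ∌ p` with `F ∈ 𝔭`, `F(T^ι) ∉ 𝔭`.
* §3 `not_sprungSharpFlatLowerDivisibility_of_printedKato_of_lam_two_of_subst_not_mem` (per pair: the (R12) datum on colour `∘`
  REFUTES the typed leaf at `∘`, modulo the printed facts), `false_of_typedInputsX8_of_iotaSelfRigidCell` (the inconsistency) and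
  its reading `not_thm714seq_sharpFlatColemanKato_zetaJoint_of_printedKato_of_iotaSelfRigidCell` (`hJ` refuted modulo print + cell).

References: Sprung, JNT 132 (2012) Thm. 2.2, Def. 6.1, Thm. 7.14 with (3), Thm. 7.16, Main Conj. 7.21 [Sprung2012]; Sprung, ANT 11
(2017) Thm. 1.12, Thm. 4.13 / Cor. 4.14 [Sprung2017]; Greenberg, LNM 1716 §1 [GreenbergLNM1716]; Greenberg 1989 §0 [Greenberg1989];
Washington, GTM 83 §7.1, §13.1 [Washington1997]; Mazur 1978 Cor. 4.1 [Mazur1978]; Greenberg–Vatsal 2000 Rem. 3.4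
[GreenbergVatsal2000]; Diamond–Shurman Thm. 8.8.3 [DiamondShurman2005] (modularity, the named fact `exists_isNewformOf`).
-/

set_option autoImplicit false
-- the problem directory `BirchSwinnertonDyer/BirchSwinnertonDyer` forces the duplicated namespace segment
set_option linter.dupNamespace false

noncomputable section

open scoped Classical NumberField MatrixGroups ModularForm

open NumberField IsDedekindDomain CongruenceSubgroup WeierstrassCurve PowerSeries
  Literature.NumberTheory.EllipticCurves Literature.NumberTheory.EllipticCurves.ModularForms
  Literature.NumberTheory.EllipticCurves.ZpExtension Literature.NumberTheory.EllipticCurves.Sprung2017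
  Literature.NumberTheory.EllipticCurves.Sprung2012 Literature.NumberTheory.EllipticCurves.Rank1Residual
  Literature.NumberTheory.EllipticCurves.IwasawaAlgebra Literature.Barriers.BirchSwinnertonDyer
  Summit.BirchSwinnertonDyer.Rank1Residual.X1.MuLambda

namespace Summit.BirchSwinnertonDyer.BirchSwinnertonDyer.Theorems

namespace ChromaticKeying

/-! ## §0 Honda systems exist (Sprung Thm. 2.2), Theses-free re-assembly -/

/-- **Sprung 2012, Theorem 2.2 — a Honda system exists** (the named fact `Sprung2012.thm22_exists_isHondaSystem`), PROVED: the
INPUTS desk's `Theorems.thm22_exists_isHondaSystem_holds` re-assembled VERBATIM from its three closing lemma files (which import no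
route file), kept `private` so the public name stays the desk's. [cite: Sprung2012, Thm. 2.2 (p. 1487), Cor. 2.10 (p. 1489)]
[cite: Kobayashi2003, Lemma 8.9, Prop. 8.11, Prop. 8.12] -/
private theorem thm22_exists_isHondaSystem_thesesFree' :
    Literature.NumberTheory.EllipticCurves.Sprung2012.thm22_exists_isHondaSystem := by
  intro W _ _ p _ hp2 hgood hap κ γ hκ _ _ v hv g hg
  obtain ⟨cneg, c, N, hN, hcneg, hc, hR0, hR1, hRn, hGEN, hGEN0⟩ :=
    SprungHonda.primalHonda_adicCompletion_of_padic W κ (W.frobeniusTrace p) v hv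
      (fun ι ↦ SprungHonda.exists_primalHonda_padic W hp2 hgood hap κ hκ ι)
  exact ⟨cneg, c, SprungHonda.isHondaSystem_of_primal κ (closureEmb (K := ℚ) (v.adicCompletion ℚ)) W
    (SprungHonda.intCast_sub_two_isUnit_of_dvd hp2 hap).2 hg hN hcneg hc hR0 hR1 hRn hGEN hGEN0⟩

/-! ## §1 The per-pair printed-input negative, arithmetic binders constructed -/

section Leaf

variable (W : WeierstrassCurve ℚ) [W.IsElliptic] [W.IsGloballyMinimal] (p : ℕ) [Fact p.Prime]

/-- **PER-PAIR NEGATIVE, PRINTED-INPUT FORM.** Sprung 2012 Thm. 7.14 ∧ Thm. 7.16 (print keying) ∧ the period unit at `3`, BY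
NAME; an X8 pair `(W, p)`, a newform `f` of `W` with Sprung pair `(L♯, L♭)`, a colour `•` and ONE prime `𝔭₀ ∌ p` of `Λ` with
`L^• ∈ 𝔭₀`, `ι(L^•) ∉ 𝔭₀` ⟹ the TYPED leaf `SprungSharpFlatLowerDivisibility W p •` is false. Every other binder of
`ChromaticKeying.not_sprungSharpFlatLowerDivisibility_of_contraKato_of_unpairedZero` is CONSTRUCTED: `(κ, γ)`
(`exists_isCyclotomic_isTopGenerator_isCyclotomicVariable_holds`), `v ∋ p` (going up), `g`
(`ZpExtension.IsCyclotomic.exists_isTopGenerator_resGalOfEmb_adicCompletion`), Honda (Sprung Thm. 2.2, PROVED), `ϖ := u⁻¹` (period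
fact), a contragredient datum (`nonempty_sharpFlatSelmerDualData_rat` at key `γ⁻¹`), the guard (`ChromaticBothColours.ClassX8.chromaticL_ne_zero`),
Kato-print (`thm716_sharpFlatCharIdeal_divisibility_contra.of_thm714`). Conditional on the displayed facts; refutes nothing.
[cite: Sprung2012, Thm. 2.2 (p. 1487), Thm. 7.14 and Thm. 7.16 (p. 1504), Main Conj. 7.21 (p. 1505)] [cite: GreenbergLNM1716, §1 (p. 60)]
[cite: Washington1997, §13.1] [cite: Mazur1978, Cor. 4.1] [cite: GreenbergVatsal2000, Rem. 3.4] -/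
theorem not_sprungSharpFlatLowerDivisibility_of_printedKato_of_unpairedZero
    (h714 : thm714_sharpFlatSelmerDual_finite_torsion) (h716c : thm716_sharpFlatCharIdeal_divisibility_contra)
    (hper : realPeriodRat_eq_unit_mul_plusPeriod_three) (hX : ClassX8 W p)
    {N : ℕ} [NeZero N] (f : CuspForm (Gamma0 N) 2) (Lsharp Lflat : IwasawaAlgebra p) (hf : IsNewformOf W f)
    (hSP : IsSprungPair f p (W.frobeniusTrace p) Lsharp Lflat) (col : Chroma)
    (𝔭₀ : PrimeSpectrum (IwasawaAlgebra p)) (hp𝔭₀ : (p : IwasawaAlgebra p) ∉ 𝔭₀.asIdeal)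
    (hL : chromaticL col Lsharp Lflat ∈ 𝔭₀.asIdeal) (hιL : invol p (chromaticL col Lsharp Lflat) ∉ 𝔭₀.asIdeal) :
    ¬ SprungSharpFlatLowerDivisibility W p col := by
  intro hleaf
  have hp2 : p ≠ 2 := by rw [hX.p_eq]; decide
  have hgood : W.HasGoodReductionAtPrime p :=
    Summit.BirchSwinnertonDyer.Rank1Residual.Supersingular.ClassX8.good W p hX
  have hss : (p : ℤ) ∣ W.frobeniusTrace p :=
    Summit.BirchSwinnertonDyer.Rank1Residual.Supersingular.ClassX8.dvd_frobeniusTrace W p hX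
  have hgood3 : W.HasGoodReductionAtPrime 3 := hX.2.1.1
  have hirr3 : W.HasIrreducibleModPGaloisRep 3 := ClassX8.irr W p hX
  -- the cyclotomic `ℤ_p`-extension with a topological generator matching the cyclotomic variable
  obtain ⟨κ, hκ, γ, hγ, hvar⟩ := exists_isCyclotomic_isTopGenerator_isCyclotomicVariable_holds p
  -- a place above `p` and a local lift of the generator
  obtain ⟨v, hv⟩ : ∃ v : HeightOneSpectrum (𝓞 ℚ), (p : 𝓞 ℚ) ∈ v.asIdeal := by
    -- going up along `ℤ → 𝓞 ℚ` (= `Theorems.exists_heightOneSpectrum_rat_natCast_mem` of the Theses-dependent file p665377,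
    -- inlined to keep this file route-independent)
    have hpℕ : p.Prime := Fact.out
    haveI hmax : (Ideal.span {(p : ℤ)}).IsMaximal :=
      PrincipalIdealRing.isMaximal_of_irreducible (Nat.prime_iff_prime_int.mp hpℕ).irreducible
    obtain ⟨Q, hQmax, hQ⟩ := Ideal.exists_ideal_over_maximal_of_isIntegral (S := 𝓞 ℚ)
      (Ideal.span {(p : ℤ)}) (by
        rw [(RingHom.injective_iff_ker_eq_bot _).mp (algebraMap ℤ (𝓞 ℚ)).injective_int]
        exact bot_le)
    have hpQ : (p : 𝓞 ℚ) ∈ Q := by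
      have : (p : ℤ) ∈ Q.comap (algebraMap ℤ (𝓞 ℚ)) := by
        rw [hQ]; exact Ideal.mem_span_singleton_self _
      simpa [Ideal.mem_comap] using this
    have hQne : Q ≠ ⊥ := by
      intro hbot
      rw [hbot, Ideal.mem_bot] at hpQ
      exact (Nat.cast_ne_zero.mpr hpℕ.ne_zero) hpQ
    exact ⟨⟨Q, hQmax.isPrime, hQne⟩, hpQ⟩
  obtain ⟨g, hg⟩ := hκ.exists_isTopGenerator_resGalOfEmb_adicCompletion v hv
  -- a Honda system (Sprung Thm. 2.2, proved in the tree)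
  obtain ⟨cneg, c, hH⟩ := thm22_exists_isHondaSystem_thesesFree' W p hp2 hgood hss κ γ hκ hγ hvar v hv g hg
  -- the period ratio `ϖ = u⁻¹` from the period unit at `3`
  obtain ⟨u, hu1, hΩ⟩ := hper W hgood3 hirr3 f hf
  have hu0 : u ≠ 0 := by
    intro h0
    rw [h0, Rat.cast_zero, norm_zero] at hu1
    exact zero_ne_one hu1
  have hϖ : ((u⁻¹ : ℚ) : ℝ) * W.realPeriodRat = plusPeriod f := by
    rw [hΩ, Rat.cast_inv, ← mul_assoc, inv_mul_cancel₀ (Rat.cast_ne_zero.mpr hu0), one_mul]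
  -- the guard of the leaf is a theorem on X8
  have hne : chromaticL col Lsharp Lflat ≠ 0 :=
    ChromaticBothColours.ClassX8.chromaticL_ne_zero W p hX f Lsharp Lflat hf hSP col
  -- a contragredient dual datum of `Sel^•` and Sprung's printed Thm. 7.16 for it (torsion by Thm. 7.14)
  obtain ⟨D'⟩ := nonempty_sharpFlatSelmerDualData_rat W κ γ⁻¹ v g c col
  have hKato : ∃ n : ℕ, (p : IwasawaAlgebra p) ^ n * chromaticL col Lsharp Lflat ∈ D'.charIdeal :=
    (h716c.of_thm714 h714 hp2 hgood hss hf hκ hγ hvar hv hg hH hSP hne D').1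
  exact not_sprungSharpFlatLowerDivisibility_of_contraKato_of_unpairedZero W p col κ γ hκ hγ hvar v hv g hg cneg c hH N
    ‹_› f u⁻¹ Lsharp Lflat hf hϖ hSP hne D' hKato 𝔭₀ hp𝔭₀ hL hιL hleaf

end Leaf

/-! ## §2 Pure algebra: the (R12) datum produces an `ι`-unpaired zero off `(p)` -/

section Algebra

variable {p : ℕ} [hp : Fact p.Prime]

/-- **An `ι`-self-rigid `λ = 2` series has an `ι`-UNPAIRED height-one zero off `(p)`.** In `Λ = ℤ_p⟦T⟧` (`p ≠ 2`): if `F ≠ 0`,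
`μ(F) = 0`, `λ(F) = 2`, `F(0) ≠ 0` and `F(T^ι) ∉ (F)` (`T^ι = (1+T)⁻¹ − 1`), then some height-one prime `𝔭` of `Λ` has
`p ∉ 𝔭`, `F ∈ 𝔭` and `F(T^ι) ∉ 𝔭`. Proof: `λ(F) = 2` makes `F` a non-unit (`isUnit_iff_mu_eq_zero_and_lam_eq_zero`), so an
irreducible `π` divides `F` (`Λ` is a UFD); `𝔭 := (π)` is a prime of height one (Krull); `p ∉ 𝔭` since otherwise `π ~ p ∣ F`
against `μ(F) = 0`; and `F(T^ι) ∉ 𝔭` is `ChromaticIota.not_mem_of_subst_mem_of_lam_two`. [cite: Washington1997, §7.1 (Thm. 7.3)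
and §13.2] [cite: GreenbergLNM1716, §1] -/
theorem exists_heightOne_unpairedZero_of_lam_two_of_subst_not_mem (hp2 : p ≠ 2) {F : IwasawaAlgebra p} (hF0 : F ≠ 0)
    (hμF : mu F = 0) (hlamF : lam F = 2) (hcF : PowerSeries.constantCoeff F ≠ 0)
    (hdat : PowerSeries.subst (invOnePlusSubOne : IwasawaAlgebra p) F ∉ Ideal.span {F}) :
    ∃ 𝔭 : PrimeSpectrum (IwasawaAlgebra p), 𝔭.asIdeal.height = 1 ∧ (p : IwasawaAlgebra p) ∉ 𝔭.asIdeal ∧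
      F ∈ 𝔭.asIdeal ∧ PowerSeries.subst (invOnePlusSubOne : IwasawaAlgebra p) F ∉ 𝔭.asIdeal := by
  -- `F` is not a unit (`λ(F) = 2 ≠ 0`)
  have hFnu : ¬ IsUnit F := by
    intro hu
    have h := ((isUnit_iff_mu_eq_zero_and_lam_eq_zero F).1 hu).2.2
    rw [hlamF] at h
    exact two_ne_zero h
  -- an irreducible (hence prime) factor `π ∣ F`
  obtain ⟨π, hπirr, hπF⟩ := WfDvdMonoid.exists_irreducible_factor hFnu hF0
  have hπ : Prime π := hπirr.prime
  haveI hprime : (Ideal.span {π}).IsPrime := (Ideal.span_singleton_prime hπ.ne_zero).mpr hπ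
  let 𝔭 : PrimeSpectrum (IwasawaAlgebra p) := ⟨Ideal.span {π}, hprime⟩
  have h1 : 𝔭.asIdeal.height = 1 := Module.height_span_singleton_eq_one_of_prime hπ
  have hF𝔭 : F ∈ 𝔭.asIdeal := Ideal.mem_span_singleton.mpr hπF
  refine ⟨𝔭, h1, ?_, hF𝔭, ChromaticIota.not_mem_of_subst_mem_of_lam_two hp2 hF0 hμF hlamF hcF hdat 𝔭 h1 hF𝔭⟩
  -- `p ∉ 𝔭`: otherwise `π ∣ p`, `π ~ p`, `p ∣ F`, `μ(F) ≥ 1`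
  intro hp𝔭
  have hπp : π ∣ (p : IwasawaAlgebra p) := Ideal.mem_span_singleton.mp hp𝔭
  have hpprime : Prime (p : IwasawaAlgebra p) := IwasawaAlgebra.prime_natCast
  have hassoc : Associated π (p : IwasawaAlgebra p) := hπirr.associated_of_dvd hpprime.irreducible hπp
  have hpF : (p : IwasawaAlgebra p) ∣ F := hassoc.symm.dvd.trans hπF
  have hC : PowerSeries.C ((p : ℤ_[p]) ^ 1) ∣ F := by
    rwa [pow_one, map_natCast]
  have h1le : 1 ≤ mu F := le_mu_of_C_pow_dvd hF0 hC
  rw [hμF] at h1le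
  exact Nat.not_succ_le_zero 0 h1le

end Algebra

/-! ## §3 The (R12) datum refutes the typed leaf at its own colour; the typed input pack is inconsistent at such a cell -/

section Inconsistency

variable (W : WeierstrassCurve ℚ) [W.IsElliptic] [W.IsGloballyMinimal] (p : ℕ) [Fact p.Prime]

/-- **PER-PAIR: the (R12) datum on colour `∘` REFUTES the typed leaf at `∘`** (modulo Sprung Thm. 7.14, Thm. 7.16 in print keying
and the period unit, by name): on an X8 pair, a newform `f` with Sprung pair and a colour `∘` with `μ(L^∘) = 0`, `λ(L^∘) = 2`,
`L^∘(0) ≠ 0`, `L^∘(T^ι) ∉ (L^∘)` give `¬ SprungSharpFlatLowerDivisibility W p ∘` — §2 supplies the `ι`-unpaired zero, §1 the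
negative. Compare (R12) `ChromaticIota.sprungSharpFlatLowerDivisibility_of_lam_two_of_subst_not_mem`, which derives the SAME leaf
(for both colours) from the SAME datum modulo `h714`, `h3` and the γ-KEYED package fact `hJ`. [cite: Sprung2012, Thm. 7.14 and
Thm. 7.16 (p. 1504), Main Conj. 7.21 (p. 1505)] [cite: GreenbergLNM1716, §1 (p. 60)] [cite: Washington1997, §7.1] -/
theorem not_sprungSharpFlatLowerDivisibility_of_printedKato_of_lam_two_of_subst_not_mem
    (h714 : thm714_sharpFlatSelmerDual_finite_torsion) (h716c : thm716_sharpFlatCharIdeal_divisibility_contra)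
    (hper : realPeriodRat_eq_unit_mul_plusPeriod_three) (hX : ClassX8 W p)
    {N : ℕ} [NeZero N] (f : CuspForm (Gamma0 N) 2) (Lsharp Lflat : IwasawaAlgebra p) (hf : IsNewformOf W f)
    (hSP : IsSprungPair f p (W.frobeniusTrace p) Lsharp Lflat) (col : Chroma)
    (hμ : mu (chromaticL col Lsharp Lflat) = 0) (hlam : lam (chromaticL col Lsharp Lflat) = 2)
    (hc0 : PowerSeries.constantCoeff (chromaticL col Lsharp Lflat) ≠ 0)
    (hnot : PowerSeries.subst (invOnePlusSubOne : IwasawaAlgebra p) (chromaticL col Lsharp Lflat) ∉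
      Ideal.span {chromaticL col Lsharp Lflat}) :
    ¬ SprungSharpFlatLowerDivisibility W p col := by
  have hp2 : p ≠ 2 := by rw [hX.p_eq]; decide
  have hF0 : chromaticL col Lsharp Lflat ≠ 0 := fun h => hc0 (by rw [h, map_zero])
  obtain ⟨𝔭₀, -, hp𝔭₀, hL, hιL⟩ := exists_heightOne_unpairedZero_of_lam_two_of_subst_not_mem hp2 hF0 hμ hlam hc0 hnot
  refine not_sprungSharpFlatLowerDivisibility_of_printedKato_of_unpairedZero W p h714 h716c hper hX f Lsharp Lflat hf hSP col
    𝔭₀ hp𝔭₀ hL ?_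
  rwa [invol_eq_subst]

/-- **THE TYPED INPUT PACK OF THE X8 ROUTES IS INCONSISTENT MODULO ONE ι-SELF-RIGID CELL.** Sprung 2012 Thm. 7.14 (`h714`), the
period unit at `3` (`h3`), the γ-KEYED joint Coleman–Kato package fact `hJ = thm714seq_sharpFlatColemanKato_zetaJoint` (x8 22571
(iii)), Sprung 2012 Thm. 7.16 IN PRINT KEYING (`h716c = thm716_sharpFlatCharIdeal_divisibility_contra`, the `_contra` sibling of
director ruling (266) R1′) and modularity (`hmod = exists_isNewformOf`) — all BY NAME — together with ONE X8 pair at which every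
newform/Sprung-pair instance has a colour `∘` with `μ(L^∘) = 0`, `λ(L^∘) = 2`, `L^∘(0) ≠ 0`, `L^∘(T^ι) ∉ (L^∘)` (the datum of door
(R12) verbatim; generic on the x8 census, decidable per cell from finitely many `3`-adic digits) prove `False`: (R12) gives the
typed leaf at that pair for every colour from `h714 ∧ h3 ∧ hJ`; the previous theorem refutes it at `∘` from `h714 ∧ h716c ∧ h3`
(the newform and the pair exist by `hmod` and `thm112_exists_isSprungPair_holds`). Kernel form of the COHERENCE WARNING behind
ruling (267): a guard pack re-keyed to `h716_contra` beside a γ-keyed `hJ` is an inconsistent pack modulo one certificate; only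
the family re-bind (γ⁻¹-keyed `hJ_contra` too) is coherent. The theorem does NOT say which fact nature falsifies (x8 R-228 /
T67: `hJ` as typed), proves nothing about BSD / K1 / K_spor, and refutes no item (the cell datum is a displayed, unconstructed
hypothesis). [cite: Sprung2012, Def. 6.1 (p. 1495), Thm. 7.14 with (3) and Thm. 7.16 (p. 1504), Main Conj. 7.21 (p. 1505)]
[cite: Sprung2017, Thm. 1.12, Thm. 4.13 and Cor. 4.14] [cite: GreenbergLNM1716, §1 (p. 60)] [cite: DiamondShurman2005, Thm. 8.8.3] -/
theorem false_of_typedInputsX8_of_iotaSelfRigidCell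
    (h714 : thm714_sharpFlatSelmerDual_finite_torsion) (h3 : realPeriodRat_eq_unit_mul_plusPeriod_three)
    (hJ : thm714seq_sharpFlatColemanKato_zetaJoint) (h716c : thm716_sharpFlatCharIdeal_divisibility_contra)
    (hmod : exists_isNewformOf) (hX : ClassX8 W p)
    (hdat : ∀ {N : ℕ} [NeZero N] (f : CuspForm (Gamma0 N) 2), IsNewformOf W f →
      ∀ Lsharp Lflat : IwasawaAlgebra p, IsSprungPair f p (W.frobeniusTrace p) Lsharp Lflat →
        ∃ col₀ : Chroma, mu (chromaticL col₀ Lsharp Lflat) = 0 ∧ lam (chromaticL col₀ Lsharp Lflat) = 2 ∧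
          PowerSeries.constantCoeff (chromaticL col₀ Lsharp Lflat) ≠ 0 ∧
          PowerSeries.subst (invOnePlusSubOne : IwasawaAlgebra p) (chromaticL col₀ Lsharp Lflat) ∉
            Ideal.span {chromaticL col₀ Lsharp Lflat}) :
    False := by
  have hp2 : p ≠ 2 := by rw [hX.p_eq]; decide
  have hgood : W.HasGoodReductionAtPrime p :=
    Summit.BirchSwinnertonDyer.Rank1Residual.Supersingular.ClassX8.good W p hX
  have hss : (p : ℤ) ∣ W.frobeniusTrace p :=
    Summit.BirchSwinnertonDyer.Rank1Residual.Supersingular.ClassX8.dvd_frobeniusTrace W p hX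
  -- the newform (modularity, by name) and the Sprung pair (Sprung 2017 Thm. 1.12, proved)
  haveI : NeZero (W.conductorNorm ℤ) := ⟨(W.conductorNorm_pos_holds).ne'⟩
  obtain ⟨f, hf⟩ := hmod W
  obtain ⟨Lsharp, Lflat, hSP⟩ := thm112_exists_isSprungPair_holds (W := W) (f := f) (p := p) hp2 hf hgood hss
  -- the (R12) datum at this instance, and the two contradicting conclusions at its colour
  obtain ⟨col₀, hμ, hlam, hc0, hnot⟩ := hdat f hf Lsharp Lflat hSP
  have hyes : SprungSharpFlatLowerDivisibility W p col₀ :=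
    ChromaticIota.sprungSharpFlatLowerDivisibility_of_lam_two_of_subst_not_mem W p h714 h3 hJ hX hdat col₀
  exact not_sprungSharpFlatLowerDivisibility_of_printedKato_of_lam_two_of_subst_not_mem W p h714 h716c h3 hX f Lsharp Lflat
    hf hSP col₀ hμ hlam hc0 hnot hyes

/-- **COROLLARY: the γ-keyed joint package fact is REFUTED modulo the printed facts and one ι-self-rigid cell.** Sprung 2012
Thm. 7.14, the period unit at `3`, Thm. 7.16 IN PRINT KEYING and modularity, BY NAME, together with ONE X8 pair carrying the (R12)
datum, give `¬ thm714seq_sharpFlatColemanKato_zetaJoint` — the kernel form of x8 ref R-228 §2 / lit T67 (m) «`hJ` FALSE AS TYPED»,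
now modulo PRINT plus one per-cell certificate instead of nature's objects. Conditional; the cell datum is a displayed hypothesis;
item 22571 is NOT closed or refuted by this (its conjunct (iii) is this fact, but the hypotheses here are unregistered named facts).
[cite: Sprung2012, Def. 6.1 (p. 1495), Thm. 7.14 with (3) and Thm. 7.16 (p. 1504)] [cite: Sprung2017, Thm. 1.12, Thm. 4.13 and Cor. 4.14] -/
theorem not_thm714seq_sharpFlatColemanKato_zetaJoint_of_printedKato_of_iotaSelfRigidCell
    (h714 : thm714_sharpFlatSelmerDual_finite_torsion) (h3 : realPeriodRat_eq_unit_mul_plusPeriod_three)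
    (h716c : thm716_sharpFlatCharIdeal_divisibility_contra) (hmod : exists_isNewformOf) (hX : ClassX8 W p)
    (hdat : ∀ {N : ℕ} [NeZero N] (f : CuspForm (Gamma0 N) 2), IsNewformOf W f →
      ∀ Lsharp Lflat : IwasawaAlgebra p, IsSprungPair f p (W.frobeniusTrace p) Lsharp Lflat →
        ∃ col₀ : Chroma, mu (chromaticL col₀ Lsharp Lflat) = 0 ∧ lam (chromaticL col₀ Lsharp Lflat) = 2 ∧
          PowerSeries.constantCoeff (chromaticL col₀ Lsharp Lflat) ≠ 0 ∧
          PowerSeries.subst (invOnePlusSubOne : IwasawaAlgebra p) (chromaticL col₀ Lsharp Lflat) ∉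
            Ideal.span {chromaticL col₀ Lsharp Lflat}) :
    ¬ thm714seq_sharpFlatColemanKato_zetaJoint :=
  fun hJ => false_of_typedInputsX8_of_iotaSelfRigidCell W p h714 h3 hJ h716c hmod hX hdat

end Inconsistency

end ChromaticKeying

end Summit.BirchSwinnertonDyer.BirchSwinnertonDyer.Theorems

end
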